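import Literature.MathematicalPhysics.QuantumFieldTheory.Balaban1983to89.B9PerturbationMajorantLetters
import Literature.MathematicalPhysics.QuantumFieldTheory.Balaban1983to89.B9PerturbationSplitAtLetters

/-!
# `Balaban1983to89.B9PerturbationMajorantsAtLetters` — [B9] (3.131) AT node00-def-Y's LETTERS: the four Δ′_π majorant hypotheses of the N06 certificate
# (dag-n06-d edition 19: `hta htb htaR htbR` about `TaLcoK TbLcoKH TaRcoK TbRcoKH`) FROM Theorem 3.1 (3.42)₁₂₃ for G′, (3.49)₁₂₃ for P = I − R and the
# (3.117)∕(3.36) current letters, read at the pinned coordinate models — with the units factor `etaS⁻²` of the pinned Sect.-D letters DISPLAYED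

T. Bałaban, *Propagators for lattice gauge theories in a background field*, Commun. Math. Phys. **99** (1985) 389–434 [`Balaban1985BackgroundPropagators`,
"B9"]; [4] = T. Bałaban, *Propagators and renormalization transformations for lattice gauge theories. II*, Commun. Math. Phys. **96** (1984) 223–250
[`Balaban1984PropagatorsII`].  statement-level skeleton of published theorems with citation tags; proofs where landed; nothing here is a claim about
the Yang–Mills mass gap.  Sequel of `B9PerturbationMajorantAlgebra` ∕ `B9PerturbationMajorantLetters` (schemas, letters, the four weighted T-majorants) and of
`B9PerturbationSplitAtLetters` (the split letters `TaLY …` and their pinned models `TaLcoK …`).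

WHAT IS DEFINED AND PROVED (0 sorry).
* §1 the per-letter coordinate models the pinned T-models factor through: `BcoKH` (the current letter B = Δ(U)∘D_U = def-Y's `hessY U ∘ gradY U`, Δ-type
  scaling `(cR39 b)⁻¹` like `TpicoK`), `BdcoKH` (B† = D\*_U∘Δ(U)), `PcoK` (P = I − R(U) = def-Y's `P349Y`, unscaled); `rcoK_eq : RcoK = (cR39 b)⁻¹ • (1 − PcoK)`;
  their `U = 1` faces (`bcoKH ∕ bdcoKH_eq_zero_of_cfg_one`).
* §2 ★ THE EXACT FACTORIZATIONS of the pinned models of `B9PerturbationSplitAtLetters` through n06-d's site model `GcoS` (which carries print's η²: `GcoS :=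
  (etaS² · cR39) • coordOpK (Gp U)`) and def-Y's `RcoK ∕ DvcoKH ∕ DvscoKH`:
  `taLcoK_eq_comp : TaLcoK = etaS⁻² • (BcoKH ∘ GcoS ∘ RcoK ∘ DvscoKH)`, `taRcoK_eq_comp : TaRcoK = etaS⁻² • (DvcoKH ∘ RcoK ∘ GcoS ∘ BdcoKH)`,
  `tbLcoKH_eq_comp : TbLcoKH = etaS⁻² • (RcoK∘GcoS∘BdcoKH) − etaS⁻⁴ • (RcoK∘GcoS∘DvscoKH∘BcoKH∘GcoS∘RcoK∘DvscoKH)`, `tbRcoKH_eq_comp` (the R-twin).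
* §3 ★★ `hta_of_letters ∕ htb_of_letters ∕ htaR_of_letters ∕ htbR_of_letters` — the four displayed majorant shapes of edition 19 (classes `cNorm … 2 → cNorm … 0`,
  `cNorm … 2 → cNorm_W … 1`, `cNorm … 2 → cNorm … 0`, `cNormR_W … 0 → cNormR … 1`; kernel `t · θ · e^{−δ_T d}` with θ the certificate's `M·α₀`) from the three
  printed-shape schemas AT THESE MODELS (`Thm31GpMaj blkW blk (GcoS … Gp U₁) (DvcoKH … U₁) (DvscoKH … U₁)`, `Proj349Maj blkW blk (PcoK … U₁) …`,
  `CurrentMaj blkW blk (BcoKH … U₁) (BdcoKH … U₁) … (t_J·θ) δ_B`) + `GeoOK` + n06-k's `Facts347` + the row sum, with the EXPLICIT constant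
  `t = (etaS⁻² [+ etaS⁻⁴]) · const3131 (cR39 b)⁻¹ B₀ C_P c L · t_J`.
LOCATED (UNITS-D1, design remark — stated once, nothing of anyone's modified; pub-ymgap bus 2026-08-27 I.24040).  The factor `etaS⁻² = L^{2k}` in §2 is not a
convention of this file: def-Y's site propagator `GpY` is the inverse of `deltaPrimeAY = lapSL + …` over the UNIT covariant Laplacian (`Node00.OpsYOfLetters`:
«site sector, lattice units»; `B6MultiLevelBoxOperator.levC`: «lattice units, η = 1») and is read as print's G′(U) only with the prefactor `etaS²`
(`Node00.kernelFamilyS`, n06-d `B9CoReadingCoordsS.GcoS`, [4] (2.67)), whereas `gradY ∕ divY ∕ hessY` are in the bond sector's physical units `c_f = L^k = etaS⁻¹`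
(`MemberY.hcfk`).  Print's π = I − D_UG′RD\*_U (3.119) composes letters of ONE system of units; the certificate's pins feed `gaugePiY ∕ deltaPiPrimeY ∕ TpicoK`
the raw `GpY`, so the pinned Δ′_π is `etaS⁻²·(BG′RD\* + DRG′B†) − etaS⁻⁴·(DRG′D\*BG′RD\*)` over the physical words — §2 is that statement, kernel-checked, and §3
therefore yields the displayed majorants with a constant that is NOT member-uniform.  Under the one-line repair at the pin (`Gp := fun U => etaS² • GpY … U`,
the owners' call) every `etaS` factor here is `1` and `B9PerturbationMajorantLetters` gives the uniform `t = 2·const3131·t_J`.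
HONEST SCOPE.  Finite-dimensional linear algebra over def-Y's letters and n06-d's coordinate functor calculus + the abstract majorant algebra of the two
predecessors; Theorem 3.1, (3.49), (3.117)∕(3.36) remain HYPOTHESIS SCHEMAS (now about named per-letter models); the Δ⁽²⁾ majorants `hta₂ htb₂ hta₂R htb₂R`
and the Hölder pair of `hL3131H` are not treated; count-neutral; N06 NOT discharged; one finite lattice at a time — nothing continuum ∕ ℝ⁴ ∕ OS ∕ mass gap ∕
Clay.  Cell `pub-ymgap` (HUMAN RULING D-0062), Track A node N06 [B9], bundle F7 rows 20–21, seat `pub-ymgap-dag-n06-l` (g14), 2026-08-27.  NEW file; imports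
def-Y's ∕ n06-d's ∕ n06-i's letters BY NAME; declares nothing in `Node00.*`; nothing landed is modified.
-/

namespace Literature.MathematicalPhysics.QuantumFieldTheory.Balaban1983to89.B9PerturbationMajorantsAtLetters

open Node00 Node00.OpsYSectDCoords B9Thm312Whole B9Thm312WholeClasses
open B9PerturbationSplitAtLetters B9PerturbationMajorantAlgebra B9PerturbationMajorantLetters
open B6KLevelCensusIndexV1 (KIdx)
open B9CoReadingCoords B9CoReadingCoordsH B9CoReadingCoordsS
open B9Thm39ReadingCoords (cR39)
open B11SectG (BlockNorm HasMaj RowSum)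
open B9Thm34Ext (toB6)
open B9RWSums343to347Whole (Facts347)
open B9Ineq349SiteComposite (etaS_pos)

noncomputable section

/-! ## §1 The per-letter coordinate models: the current letters B, B†, the projection P = I − R -/

section Models

variable {𝔸 : Type} [NormedRing 𝔸] [NormedAlgebra ℂ 𝔸] [CompleteSpace 𝔸] [FiniteDimensional ℝ 𝔸]
variable {κ : Type} [Fintype κ]
variable {d ℓ : ℕ} {hd : 1 ≤ d + 1} {hL : Odd (ℓ + 1) ∧ 1 < ℓ + 1} {b₀ b₁ : ℝ} (i : KIdx d ℓ hd hL b₀ b₁)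
  (b : Module.Basis κ ℝ 𝔸) (B : B9.Backgrounds) (cfg : B.Cfg → CfgY 𝔸 i) (parS : SiteParY 𝔸 i) (Gp : SiteOpY 𝔸 i)

/-- **the model of the current letter B(U) = Δ(U)∘D_U** (sites → bonds) in def-Y's physical units, Δ-type scaling `(cR39 b)⁻¹` (as `TpicoK`).
[cite: Balaban1985BackgroundPropagators, (3.117) p.419, (3.10) p.392, (3.3) p.390] -/
def BcoKH (U₁ : B.Cfg) : (XSK κ i → ℝ) →ₗ[ℝ] (XBK κ i → ℝ) :=
  (cR39 b)⁻¹ • coordOpKH b (fun _ : Fin (d + 1) => (hessGradY i (cfg U₁)).restrictScalars ℝ)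

/-- **the model of the transposed current letter B†(U) = D\*_U∘Δ(U)** (bonds → sites), scaling `(cR39 b)⁻¹`.
[cite: Balaban1985BackgroundPropagators, (3.117) p.419, (3.8) p.392, p.421] -/
def BdcoKH (U₁ : B.Cfg) : (XBK κ i → ℝ) →ₗ[ℝ] (XSK κ i → ℝ) :=
  (cR39 b)⁻¹ • coordOpKH b (fun _ : Fin (d + 1) => (divHessY i (cfg U₁)).restrictScalars ℝ)

/-- **the model of P(U) = I − R(U)** ((3.21) ∕ (3.49); def-Y's `P349Y`), unscaled. [cite: Balaban1985BackgroundPropagators, (3.21) p.394, (3.49) p.399] -/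
def PcoK (U₁ : B.Cfg) : (XSK κ i → ℝ) →ₗ[ℝ] (XSK κ i → ℝ) :=
  coordOpK b (fun _ : Fin (d + 1) => (P349Y i parS Gp (cfg U₁)).restrictScalars ℝ)

omit [CompleteSpace 𝔸] [FiniteDimensional ℝ 𝔸] in
/-- `restrictScalars` through composition (definitional). [cite: Balaban1985BackgroundPropagators, (3.120) p.419, dictionary] -/
private theorem rS_comp {T₁ T₂ T₃ : Type} (f : (T₂ → 𝔸) →ₗ[ℂ] (T₃ → 𝔸)) (g : (T₁ → 𝔸) →ₗ[ℂ] (T₂ → 𝔸)) :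
    (f ∘ₗ g).restrictScalars ℝ = f.restrictScalars ℝ ∘ₗ g.restrictScalars ℝ := rfl

omit [CompleteSpace 𝔸] [FiniteDimensional ℝ 𝔸] in
/-- `restrictScalars` through differences (definitional). [cite: Balaban1985BackgroundPropagators, (3.120) p.419, dictionary] -/
private theorem rS_sub {T₁ T₂ : Type} (f g : (T₁ → 𝔸) →ₗ[ℂ] (T₂ → 𝔸)) :
    (f - g).restrictScalars ℝ = f.restrictScalars ℝ - g.restrictScalars ℝ := rfl

omit [CompleteSpace 𝔸] [FiniteDimensional ℝ 𝔸] in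
/-- `restrictScalars` of the identity (definitional). [cite: Balaban1985BackgroundPropagators, (3.21) p.394, dictionary] -/
private theorem rS_id {T₁ : Type} : (LinearMap.id : (T₁ → 𝔸) →ₗ[ℂ] (T₁ → 𝔸)).restrictScalars ℝ = LinearMap.id := rfl

omit [CompleteSpace 𝔸] [FiniteDimensional ℝ 𝔸] in
/-- the mixed coordinate model of the zero family is zero. [cite: Balaban1985BackgroundPropagators, (3.126) p.420, dictionary] -/
private theorem coordOpKH_const_zero'' {S S' D : Type} : coordOpKH b (fun _ : D => (0 : (S' → 𝔸) →ₗ[ℝ] (S → 𝔸))) = 0 := by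
  have h := coordOpKH_smul b (0 : ℝ) (fun _ : D => (0 : (S' → 𝔸) →ₗ[ℝ] (S → 𝔸)))
  simpa only [smul_zero, zero_smul] using h

/-- ★ `R = c⁻¹(1 − P)` at the models: def-Y's pinned `RcoK` IS `(cR39 b)⁻¹ • (1 − PcoK)` (P = I − R by definition of `P349Y`).
[cite: Balaban1985BackgroundPropagators, (3.21) p.394, (3.49) p.399 («P = I − R»)] -/
theorem rcoK_eq (U₁ : B.Cfg) : RcoK i b B cfg parS Gp U₁ = (cR39 b)⁻¹ • (LinearMap.id - PcoK i b B cfg parS Gp U₁) := by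
  have hRP : RY i parS Gp (cfg U₁) = LinearMap.id - P349Y i parS Gp (cfg U₁) := by
    rw [P349Y, sub_sub_cancel]
  rw [RcoK, PcoK, hRP, rS_sub, rS_id, coordOpK_const_sub, coordOpK_id]

/-- at a configuration reading `1`: `BcoKH = 0` (B(1) = Δ(1)∘D_1 = 0, def-Y). [cite: Balaban1985BackgroundPropagators, (3.117) p.419, Cor. 3.5 p.407] -/
theorem bcoKH_eq_zero_of_cfg_one {U₁ : B.Cfg} (hU₁ : cfg U₁ = fun _ _ => 1) : BcoKH i b B cfg U₁ = 0 := by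
  rw [BcoKH, hU₁, hessGradY_one, LinearMap.restrictScalars_zero, coordOpKH_const_zero'', smul_zero]

/-- at a configuration reading `1`: `BdcoKH = 0`. [cite: Balaban1985BackgroundPropagators, (3.117) p.419, Cor. 3.5 p.407] -/
theorem bdcoKH_eq_zero_of_cfg_one {U₁ : B.Cfg} (hU₁ : cfg U₁ = fun _ _ => 1) : BdcoKH i b B cfg U₁ = 0 := by
  rw [BdcoKH, hU₁, divHessY_one, LinearMap.restrictScalars_zero, coordOpKH_const_zero'', smul_zero]

/-! ## §2 The exact factorizations of the pinned T-models through `GcoS ∕ RcoK ∕ DvcoKH ∕ DvscoKH ∕ BcoKH ∕ BdcoKH` — the `etaS` powers displayed -/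

omit [CompleteSpace 𝔸] in
/-- the scalars of one site-propagator factor: `c⁻¹·(η²c)·c⁻¹·… = η⁻²`-type bookkeeping, i.e. `(η²)⁻¹·(c⁻¹·(η²c)·c⁻¹) = c⁻¹`.
[cite: Balaban1985BackgroundPropagators, (3.120)–(3.121) pp.419–420, dictionary] -/
private theorem scal₁ (hc : cR39 b ≠ 0) :
    (etaS i ^ 2)⁻¹ * ((cR39 b)⁻¹ * (etaS i ^ 2 * cR39 b) * (cR39 b)⁻¹) = (cR39 b)⁻¹ := by
  have hη : etaS i ≠ 0 := (etaS_pos i).ne'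
  field_simp

omit [CompleteSpace 𝔸] in
/-- the scalars of the word with two site-propagator factors: `(η²)⁻²·(c⁻¹(η²c)c⁻¹(η²c)c⁻¹) = c⁻¹`.
[cite: Balaban1985BackgroundPropagators, (3.120)–(3.121) pp.419–420, dictionary] -/
private theorem scal₂ (hc : cR39 b ≠ 0) :
    ((etaS i ^ 2)⁻¹) ^ 2 * ((cR39 b)⁻¹ * (etaS i ^ 2 * cR39 b) * (cR39 b)⁻¹ * (etaS i ^ 2 * cR39 b) * (cR39 b)⁻¹) = (cR39 b)⁻¹ := by
  have hη : etaS i ≠ 0 := (etaS_pos i).ne'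
  field_simp

/-- ★ **T_a AT THE PINS FACTORS THROUGH THE LETTER MODELS WITH THE UNITS FACTOR etaS⁻²**: `TaLcoK = (etaS²)⁻¹ • (BcoKH ∘ GcoS ∘ RcoK ∘ DvscoKH)` — the word
B·G′·R·D\* over the physical current model, n06-d's site model of G′ (print's η²G′) and def-Y's `RcoK`, `DvscoKH`.
[cite: Balaban1985BackgroundPropagators, (3.120)–(3.121) pp.419–420, (3.131) p.422; Balaban1984PropagatorsII, (2.67) p.234] -/
theorem taLcoK_eq_comp (hc : cR39 b ≠ 0) (U₁ : B.Cfg) :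
    TaLcoK i b B cfg parS Gp U₁ = (etaS i ^ 2)⁻¹ •
      (BcoKH i b B cfg U₁ ∘ₗ GcoS i b B cfg Gp U₁ ∘ₗ RcoK i b B cfg parS Gp U₁ ∘ₗ DvscoKH i b B cfg U₁) := by
  rw [BcoKH, GcoS, RcoK, DvscoKH, TaLcoK, TaLY]
  simp only [hessGradY, LinearMap.comp_assoc, LinearMap.smul_comp, LinearMap.comp_smul, smul_smul, rS_comp,
    coordOpK_const_comp_coordOpKH_const, coordOpKH_const_comp_coordOpKH_const, coordOpKH_eq_coordOpK]
  rw [scal₁ i b hc]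

/-- ★ **T_a′ AT THE PINS**: `TaRcoK = (etaS²)⁻¹ • (DvcoKH ∘ RcoK ∘ GcoS ∘ BdcoKH)` (the word D·R·G′·B†).
[cite: Balaban1985BackgroundPropagators, (3.120)–(3.121) pp.419–420, (3.131) p.422; Balaban1984PropagatorsII, (2.26) p.228, (2.67) p.234] -/
theorem taRcoK_eq_comp (hc : cR39 b ≠ 0) (U₁ : B.Cfg) :
    TaRcoK i b B cfg parS Gp U₁ = (etaS i ^ 2)⁻¹ •
      (DvcoKH i b B cfg U₁ ∘ₗ RcoK i b B cfg parS Gp U₁ ∘ₗ GcoS i b B cfg Gp U₁ ∘ₗ BdcoKH i b B cfg U₁) := by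
  rw [BdcoKH, GcoS, RcoK, DvcoKH, TaRcoK, TaRY]
  simp only [divHessY, LinearMap.smul_comp, LinearMap.comp_smul, smul_smul, rS_comp,
    coordOpK_const_comp_coordOpKH_const, coordOpKH_const_comp_coordOpKH_const, coordOpKH_eq_coordOpK]
  rw [scal₁ i b hc]

/-- ★ **T_b AT THE PINS**: `TbLcoKH = (etaS²)⁻¹ • (RcoK∘GcoS∘BdcoKH) − (etaS²)⁻² • (RcoK∘GcoS∘DvscoKH∘BcoKH∘GcoS∘RcoK∘DvscoKH)` — the two words R·G′·B† and
R·G′·D\*·B·G′·R·D\* carry DIFFERENT powers of the units factor (one, resp. two site-propagator factors).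
[cite: Balaban1985BackgroundPropagators, (3.120)–(3.121) pp.419–420, (3.131) p.422; Balaban1984PropagatorsII, (2.67) p.234] -/
theorem tbLcoKH_eq_comp (hc : cR39 b ≠ 0) (U₁ : B.Cfg) :
    TbLcoKH i b B cfg parS Gp U₁ =
      (etaS i ^ 2)⁻¹ • (RcoK i b B cfg parS Gp U₁ ∘ₗ GcoS i b B cfg Gp U₁ ∘ₗ BdcoKH i b B cfg U₁) -
      ((etaS i ^ 2)⁻¹) ^ 2 • (RcoK i b B cfg parS Gp U₁ ∘ₗ GcoS i b B cfg Gp U₁ ∘ₗ DvscoKH i b B cfg U₁ ∘ₗ BcoKH i b B cfg U₁ ∘ₗ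
        GcoS i b B cfg Gp U₁ ∘ₗ RcoK i b B cfg parS Gp U₁ ∘ₗ DvscoKH i b B cfg U₁) := by
  rw [BcoKH, BdcoKH, GcoS, RcoK, DvscoKH, TbLcoKH, TbLY]
  simp only [hessGradY, divHessY, LinearMap.comp_assoc, LinearMap.smul_comp, LinearMap.comp_smul, smul_smul, rS_comp, rS_sub,
    coordOpK_const_comp_coordOpKH_const, coordOpKH_const_comp_coordOpK_const, coordOpKH_const_comp_coordOpKH_const,
    coordOpKH_eq_coordOpK, coordOpKH_sub, smul_sub]
  rw [scal₁ i b hc, scal₂ i b hc]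

/-- ★ **T_b′ AT THE PINS**: `TbRcoKH = (etaS²)⁻¹ • (BcoKH∘GcoS∘RcoK) − (etaS²)⁻² • (DvcoKH∘RcoK∘GcoS∘BdcoKH∘DvcoKH∘GcoS∘RcoK)` (the word
D·R·G′·(D\*Δ)·D·G′·R, `divY ∘ (hessY ∘ gradY) = (divY ∘ hessY) ∘ gradY`).
[cite: Balaban1985BackgroundPropagators, (3.120)–(3.121) pp.419–420, (3.131) p.422; Balaban1984PropagatorsII, (2.26) p.228, (2.67) p.234] -/
theorem tbRcoKH_eq_comp (hc : cR39 b ≠ 0) (U₁ : B.Cfg) :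
    TbRcoKH i b B cfg parS Gp U₁ =
      (etaS i ^ 2)⁻¹ • (BcoKH i b B cfg U₁ ∘ₗ GcoS i b B cfg Gp U₁ ∘ₗ RcoK i b B cfg parS Gp U₁) -
      ((etaS i ^ 2)⁻¹) ^ 2 • (DvcoKH i b B cfg U₁ ∘ₗ RcoK i b B cfg parS Gp U₁ ∘ₗ GcoS i b B cfg Gp U₁ ∘ₗ BdcoKH i b B cfg U₁ ∘ₗ
        DvcoKH i b B cfg U₁ ∘ₗ GcoS i b B cfg Gp U₁ ∘ₗ RcoK i b B cfg parS Gp U₁) := by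
  rw [BcoKH, BdcoKH, GcoS, RcoK, DvcoKH, TbRcoKH, TbRY]
  simp only [hessGradY, divHessY, LinearMap.comp_assoc, LinearMap.smul_comp, LinearMap.comp_smul, smul_smul, rS_comp, rS_sub,
    coordOpK_comp, coordOpKH_const_comp_coordOpK_const, coordOpKH_const_comp_coordOpKH_const,
    coordOpKH_eq_coordOpK, coordOpKH_sub, smul_sub]
  rw [scal₁ i b hc, scal₂ i b hc]

end Models

/-! ## §3 The four displayed Δ′_π majorants of the certificate (edition 19) from the three schemas at the pinned models -/

section Majorants

variable {𝔸 : Type} [NormedRing 𝔸] [NormedAlgebra ℂ 𝔸] [CompleteSpace 𝔸] [FiniteDimensional ℝ 𝔸]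
variable {κ : Type} [Fintype κ]
variable {d ℓ : ℕ} {hd : 1 ≤ d + 1} {hL : Odd (ℓ + 1) ∧ 1 < ℓ + 1} {b₀ b₁ : ℝ}
variable {g : B9.Geometry} [Fintype g.Site] {R₀ : ℝ} {H₀ : Prop}
variable {i : KIdx d ℓ hd hL b₀ b₁} {b : Module.Basis κ ℝ 𝔸} {B : B9.Backgrounds} {cfg : B.Cfg → CfgY 𝔸 i}
  {parS : SiteParY 𝔸 i} {Gp : SiteOpY 𝔸 i} {U₁ : B.Cfg} {blkW : XSK κ i → g.Site} {blk : XBK κ i → g.Site}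
  {B₀ δ₀ CP δP tJ θ δB r δT σ c : ℝ} {dF : ℕ} {δ α L₀ : ℝ}

/-- ★★ **`hta` OF EDITION 19 FROM THE LETTERS**: at the pinned models, Theorem 3.1 (3.42)₁₂₃ for G′ (`Thm31GpMaj` at `GcoS ∕ DvcoKH ∕ DvscoKH`), (3.49)₁₂₃ for P
(`Proj349Maj` at `PcoK`) and the current letters (`CurrentMaj` at `BcoKH ∕ BdcoKH`, size t_J·θ with θ the certificate's M·α₀) give the displayed majorant of
`TaLcoK` between `cNorm … 2 → cNorm … 0` with the kernel `t·θ·e^{−δ_T d}`, **t = etaS⁻²·const3131·t_J** (NOT member-uniform — LOCATED-UNITS-D1 of the header),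
for every δ_T ≧ 0 with δ_T + 2σ + 3αδ ≦ r ≦ min(δ₀, δ_P, δ_B).
[cite: Balaban1985BackgroundPropagators, (3.130)–(3.131) pp.421–422, (3.42) p.397, (3.49) p.399, (3.117) p.419, (3.36) p.396; Balaban1984PropagatorsII, (2.54), (2.60)–(2.61) pp.233–234] -/
theorem hta_of_letters (hG : GeoOK g) (hF : Facts347 g R₀ H₀ dF δ α L₀) (hrow : RowSum (toB6 g R₀ H₀) σ c) (hc0 : 0 < cR39 b)
    (h31 : Thm31GpMaj blkW blk (GcoS i b B cfg Gp U₁) (DvcoKH i b B cfg U₁) (DvscoKH i b B cfg U₁) R₀ H₀ B₀ δ₀)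
    (h49 : Proj349Maj blkW blk (PcoK i b B cfg parS Gp U₁) (DvcoKH i b B cfg U₁) (DvscoKH i b B cfg U₁) R₀ H₀ CP δP)
    (hB : CurrentMaj blkW blk (BcoKH i b B cfg U₁) (BdcoKH i b B cfg U₁) R₀ H₀ (tJ * θ) δB)
    (hB₀ : 0 ≤ B₀) (hCP : 0 ≤ CP) (htJ : 0 ≤ tJ) (hθ : 0 ≤ θ) (hc : 0 ≤ c) (hσ : 0 ≤ σ) (hτ : 0 ≤ α * δ)
    (hr₀ : r ≤ δ₀) (hrP : r ≤ δP) (hrB : r ≤ δB) (hδT₀ : 0 ≤ δT) (hδT : δT + 2 * σ + 3 * (α * δ) ≤ r) :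
    HasMaj (cNorm R₀ H₀ blk hG.lenle 2) (cNorm R₀ H₀ blk hG.lenle 0) (TaLcoK i b B cfg parS Gp U₁)
      (fun a a' => (etaS i ^ 2)⁻¹ * const3131 (cR39 b)⁻¹ B₀ CP c g.L * tJ * θ * Real.exp (-(δT * g.dist a a'))) := by
  rw [taLcoK_eq_comp i b B cfg parS Gp hc0.ne']
  have h := maj_taL hG hF hrow h31 h49 hB (rcoK_eq i b B cfg parS Gp U₁) (inv_nonneg.mpr hc0.le) hB₀ hCP (mul_nonneg htJ hθ) hc hσ hτ
    hr₀ hrP hrB hδT₀ hδT ((etaS i ^ 2)⁻¹)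
  refine h.mono fun a a' => le_of_eq ?_
  show |(etaS i ^ 2)⁻¹| * (const3131 (cR39 b)⁻¹ B₀ CP c g.L * (tJ * θ)) * Real.exp (-(δT * g.dist a a')) = _
  rw [abs_of_nonneg (inv_nonneg.mpr (pow_nonneg (etaS_pos i).le 2))]
  ring

/-- ★★ **`htb` OF EDITION 19 FROM THE LETTERS**: the displayed majorant of `TbLcoKH` between `cNorm … blk 2 → cNorm … blkW 1`, kernel `t·θ·e^{−δ_T d}` with
**t = (etaS⁻² + etaS⁻⁴)·const3131·t_J** (the two words of T_b carry different powers of the units factor).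
[cite: Balaban1985BackgroundPropagators, (3.130)–(3.131) pp.421–422, (3.42) p.397, (3.49) p.399, (3.117) p.419, (3.36) p.396; Balaban1984PropagatorsII, (2.54), (2.60)–(2.61) pp.233–234] -/
theorem htb_of_letters (hG : GeoOK g) (hF : Facts347 g R₀ H₀ dF δ α L₀) (hrow : RowSum (toB6 g R₀ H₀) σ c) (hc0 : 0 < cR39 b)
    (h31 : Thm31GpMaj blkW blk (GcoS i b B cfg Gp U₁) (DvcoKH i b B cfg U₁) (DvscoKH i b B cfg U₁) R₀ H₀ B₀ δ₀)
    (h49 : Proj349Maj blkW blk (PcoK i b B cfg parS Gp U₁) (DvcoKH i b B cfg U₁) (DvscoKH i b B cfg U₁) R₀ H₀ CP δP)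
    (hB : CurrentMaj blkW blk (BcoKH i b B cfg U₁) (BdcoKH i b B cfg U₁) R₀ H₀ (tJ * θ) δB)
    (hB₀ : 0 ≤ B₀) (hCP : 0 ≤ CP) (htJ : 0 ≤ tJ) (hθ : 0 ≤ θ) (hc : 0 ≤ c) (hσ : 0 ≤ σ) (hτ : 0 ≤ α * δ)
    (hr₀ : r ≤ δ₀) (hrP : r ≤ δP) (hrB : r ≤ δB) (hδT₀ : 0 ≤ δT) (hδT : δT + 2 * σ + 3 * (α * δ) ≤ r) :
    HasMaj (cNorm R₀ H₀ blk hG.lenle 2) (cNorm R₀ H₀ blkW hG.lenle 1) (TbLcoKH i b B cfg parS Gp U₁)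
      (fun a a' => ((etaS i ^ 2)⁻¹ + ((etaS i ^ 2)⁻¹) ^ 2) * const3131 (cR39 b)⁻¹ B₀ CP c g.L * tJ * θ *
        Real.exp (-(δT * g.dist a a'))) := by
  rw [tbLcoKH_eq_comp i b B cfg parS Gp hc0.ne']
  have h := maj_tbL hG hF hrow h31 h49 hB (rcoK_eq i b B cfg parS Gp U₁) (inv_nonneg.mpr hc0.le) hB₀ hCP (mul_nonneg htJ hθ) hc hσ hτ
    hr₀ hrP hrB hδT₀ hδT ((etaS i ^ 2)⁻¹) (((etaS i ^ 2)⁻¹) ^ 2)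
  refine h.mono fun a a' => le_of_eq ?_
  have hη : 0 ≤ (etaS i ^ 2)⁻¹ := inv_nonneg.mpr (pow_nonneg (etaS_pos i).le 2)
  show (|(etaS i ^ 2)⁻¹| + |((etaS i ^ 2)⁻¹) ^ 2|) * (const3131 (cR39 b)⁻¹ B₀ CP c g.L * (tJ * θ)) * Real.exp (-(δT * g.dist a a')) = _
  rw [abs_of_nonneg hη, abs_of_nonneg (pow_nonneg hη 2)]
  ring

/-- ★★ **`htaR` OF EDITION 19 FROM THE LETTERS**: the displayed majorant of `TaRcoK` between `cNorm … 2 → cNorm … 0`, **t = etaS⁻²·const3131·t_J**.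
[cite: Balaban1985BackgroundPropagators, (3.130)–(3.131) pp.421–422, (3.42) p.397, (3.49) p.399, (3.117) p.419; Balaban1984PropagatorsII, (2.26) p.228, (2.54), (2.60)–(2.61) pp.233–234] -/
theorem htaR_of_letters (hG : GeoOK g) (hF : Facts347 g R₀ H₀ dF δ α L₀) (hrow : RowSum (toB6 g R₀ H₀) σ c) (hc0 : 0 < cR39 b)
    (h31 : Thm31GpMaj blkW blk (GcoS i b B cfg Gp U₁) (DvcoKH i b B cfg U₁) (DvscoKH i b B cfg U₁) R₀ H₀ B₀ δ₀)
    (h49 : Proj349Maj blkW blk (PcoK i b B cfg parS Gp U₁) (DvcoKH i b B cfg U₁) (DvscoKH i b B cfg U₁) R₀ H₀ CP δP)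
    (hB : CurrentMaj blkW blk (BcoKH i b B cfg U₁) (BdcoKH i b B cfg U₁) R₀ H₀ (tJ * θ) δB)
    (hB₀ : 0 ≤ B₀) (hCP : 0 ≤ CP) (htJ : 0 ≤ tJ) (hθ : 0 ≤ θ) (hc : 0 ≤ c) (hσ : 0 ≤ σ) (hτ : 0 ≤ α * δ)
    (hr₀ : r ≤ δ₀) (hrP : r ≤ δP) (hrB : r ≤ δB) (hδT₀ : 0 ≤ δT) (hδT : δT + 2 * σ + 3 * (α * δ) ≤ r) :
    HasMaj (cNorm R₀ H₀ blk hG.lenle 2) (cNorm R₀ H₀ blk hG.lenle 0) (TaRcoK i b B cfg parS Gp U₁)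
      (fun a a' => (etaS i ^ 2)⁻¹ * const3131 (cR39 b)⁻¹ B₀ CP c g.L * tJ * θ * Real.exp (-(δT * g.dist a a'))) := by
  rw [taRcoK_eq_comp i b B cfg parS Gp hc0.ne']
  have h := maj_taR hG hF hrow h31 h49 hB (rcoK_eq i b B cfg parS Gp U₁) (inv_nonneg.mpr hc0.le) hB₀ hCP (mul_nonneg htJ hθ) hc hσ hτ
    hr₀ hrP hrB hδT₀ hδT ((etaS i ^ 2)⁻¹)
  refine h.mono fun a a' => le_of_eq ?_
  show |(etaS i ^ 2)⁻¹| * (const3131 (cR39 b)⁻¹ B₀ CP c g.L * (tJ * θ)) * Real.exp (-(δT * g.dist a a')) = _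
  rw [abs_of_nonneg (inv_nonneg.mpr (pow_nonneg (etaS_pos i).le 2))]
  ring

/-- ★★ **`htbR` OF EDITION 19 FROM THE LETTERS**: the displayed majorant of `TbRcoKH` between the real-weight classes `cNormR … blkW 0 → cNormR … blk 1`,
**t = (etaS⁻² + etaS⁻⁴)·const3131·t_J**.
[cite: Balaban1985BackgroundPropagators, (3.130)–(3.131) pp.421–422, (3.42) p.397, (3.49) p.399, (3.117) p.419; Balaban1984PropagatorsII, (2.26) p.228, (2.54), (2.60)–(2.61) pp.233–234] -/
theorem htbR_of_letters (hG : GeoOK g) (hF : Facts347 g R₀ H₀ dF δ α L₀) (hrow : RowSum (toB6 g R₀ H₀) σ c) (hc0 : 0 < cR39 b)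
    (h31 : Thm31GpMaj blkW blk (GcoS i b B cfg Gp U₁) (DvcoKH i b B cfg U₁) (DvscoKH i b B cfg U₁) R₀ H₀ B₀ δ₀)
    (h49 : Proj349Maj blkW blk (PcoK i b B cfg parS Gp U₁) (DvcoKH i b B cfg U₁) (DvscoKH i b B cfg U₁) R₀ H₀ CP δP)
    (hB : CurrentMaj blkW blk (BcoKH i b B cfg U₁) (BdcoKH i b B cfg U₁) R₀ H₀ (tJ * θ) δB)
    (hB₀ : 0 ≤ B₀) (hCP : 0 ≤ CP) (htJ : 0 ≤ tJ) (hθ : 0 ≤ θ) (hc : 0 ≤ c) (hσ : 0 ≤ σ) (hτ : 0 ≤ α * δ)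
    (hr₀ : r ≤ δ₀) (hrP : r ≤ δP) (hrB : r ≤ δB) (hδT₀ : 0 ≤ δT) (hδT : δT + 2 * σ + 3 * (α * δ) ≤ r) :
    HasMaj (cNormR R₀ H₀ blkW hG.lenle 0) (cNormR R₀ H₀ blk hG.lenle 1) (TbRcoKH i b B cfg parS Gp U₁)
      (fun a a' => ((etaS i ^ 2)⁻¹ + ((etaS i ^ 2)⁻¹) ^ 2) * const3131 (cR39 b)⁻¹ B₀ CP c g.L * tJ * θ *
        Real.exp (-(δT * g.dist a a'))) := by
  rw [tbRcoKH_eq_comp i b B cfg parS Gp hc0.ne']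
  have h := maj_tbR hG hF hrow h31 h49 hB (rcoK_eq i b B cfg parS Gp U₁) (inv_nonneg.mpr hc0.le) hB₀ hCP (mul_nonneg htJ hθ) hc hσ hτ
    hr₀ hrP hrB hδT₀ hδT ((etaS i ^ 2)⁻¹) (((etaS i ^ 2)⁻¹) ^ 2)
  refine h.mono fun a a' => le_of_eq ?_
  have hη : 0 ≤ (etaS i ^ 2)⁻¹ := inv_nonneg.mpr (pow_nonneg (etaS_pos i).le 2)
  show (|(etaS i ^ 2)⁻¹| + |((etaS i ^ 2)⁻¹) ^ 2|) * (const3131 (cR39 b)⁻¹ B₀ CP c g.L * (tJ * θ)) * Real.exp (-(δT * g.dist a a')) = _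
  rw [abs_of_nonneg hη, abs_of_nonneg (pow_nonneg hη 2)]
  ring

end Majorants

end

end Literature.MathematicalPhysics.QuantumFieldTheory.Balaban1983to89.B9PerturbationMajorantsAtLetters
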